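import Literature.AlgebraicTopology.Homotopy.StellarCells
import Literature.AlgebraicTopology.Homotopy.SimplexHatPerm
import Literature.AlgebraicTopology.Homotopy.SlabAdditivity
import HarnessLib

/-!
# The pieces of a stellar sphere and their classes

Topic `Literature/AlgebraicTopology/Homotopy`, continuing `StellarCells.lean` and
`SimplexHatPerm.lean`. A based simplicial sphere `G : Δᵏ → X` is **stellar** with faces
`g₀, …, g_k` if on each region `{νⱼ minimal}` it is `gⱼ` read through the stellar map:
`G ν = gⱼ (stellarPt j ν _)`. The hat of `G` then splits into the pieces
`stellarPiece G … j = piece (hat G) (stellarCell j)`, and this file computes their classes: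

* `stellarAff₀` (`z ↦ z + (∑ zᵢ - 1) 𝟙`, determinant `1 + k > 0`) and
  `piece_hat_stellarCell_zero`: the piece on the cell `0` of the hat of any sphere which is `h` read
  through `stellarPt 0` on the region `0` is `hat h ∘ stellarAff₀`; so its class is `toClass (hat h)`;
* the region `j ≥ 1` is moved to the region `0` by the vertex transposition `swap 0 j`, under which
  the stellar maps correspond through the vertex permutation `Fin.cycleRange j * swap 0 j`
  (`stellarPt_mapCM_swap`), of sign `(-1)^(j+1)`;
* `toClass_stellarPiece`: **`toClass (stellarPiece G … j) = toClass (hat gⱼ) ^ (-1)^j`**.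

Everything is proved; `[folklore]` (Hatcher, *Algebraic Topology* (2002), §4.1, p. 341 and §2.1,
p. 105 for the orientation signs of the faces of a simplex).

## References

* A. Hatcher, *Algebraic Topology*, CUP (2002), §2.1 p. 105, §4.1 p. 341. [HatcherAT2002]
-/

noncomputable section

open Set Metric Topology Matrix Equiv
open scoped Topology.Homotopy

universe u

namespace Literature.AlgebraicTopology.Homotopy

variable {k : ℕ} {X : Type u} [TopologicalSpace X] {x₀ : X}

/-! ### The corner simplex in terms of barycentric coordinates -/

/-- A point whose barycentric coordinates lie in the standard simplex lies in the corner simplex.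
[folklore] -/
theorem mem_cornerSimplex_of_baryCoords {y : Fin k → ℝ} (h : ∀ i, 0 ≤ baryCoords y i) :
    y ∈ cornerSimplex k := by
  refine ⟨fun i => by simpa using h i.succ, ?_⟩
  have := h 0; rw [baryCoords_zero] at this; linarith

/-! ### Stellar spheres and their pieces -/

/-- `G` is a **stellar sphere** with faces `g`: on the region `{νⱼ minimal}` it is `gⱼ` read
through the stellar map. [folklore] -/
def IsStellar (G : C(stdSimplex ℝ (Fin (k + 1)), X)) (g : Fin (k + 1) → C(stdSimplex ℝ (Fin (k + 1)), X)) :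
    Prop :=
  ∀ (s : stdSimplex ℝ (Fin (k + 1))) (j : Fin (k + 1)) (h : ∀ l, s j ≤ s l), G s = g j (stellarPt j s h)

namespace CSphere

variable {G : C(stdSimplex ℝ (Fin (k + 1)), X)} {g : Fin (k + 1) → C(stdSimplex ℝ (Fin (k + 1)), X)}

/-- **The hat of a stellar sphere vanishes off the interior of each stellar cell** (there two
minimal coordinates coincide or a coordinate vanishes, so the stellar point is on the boundary).
[folklore] -/
theorem hat_eq_of_not_mem_interior_stellarCell (hG : IsBased x₀ G) (hg : ∀ j, IsBased x₀ (g j))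
    (hGg : IsStellar G g) {j : Fin (k + 1)} {y : Fin k → ℝ} (hy : y ∈ stellarCell j)
    (hy' : y ∉ interior (stellarCell j)) : hat G hG y = x₀ := by
  rw [hat_apply_of_mem G hG hy.1, hGg (baryPt y hy.1) j (fun l => hy.2 l)]
  exact hg j _ (exists_stellarPt_eq_zero j _ _ ((eq_or_zero_of_not_mem_interior hy hy').imp
    (fun ⟨l, hl, h⟩ => ⟨l, hl, h⟩) fun ⟨i, hi⟩ => ⟨i, hi⟩))

/-- **The piece** of the hat of a stellar sphere on the stellar cell `j`. [folklore] -/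
def stellarPiece (G : C(stdSimplex ℝ (Fin (k + 1)), X)) (hG : IsBased x₀ G)
    (g : Fin (k + 1) → C(stdSimplex ℝ (Fin (k + 1)), X)) (hg : ∀ j, IsBased x₀ (g j))
    (hGg : IsStellar G g) (j : Fin (k + 1)) : CSphere k X x₀ :=
  piece (hat G hG) (stellarCell j) fun _ hy =>
    hat_eq_of_not_mem_interior_stellarCell hG hg hGg
      ((isClosed_stellarCell j).frontier_subset hy) (disjoint_left.1 disjoint_interior_frontier.symm hy)

open scoped Classical in
/-- The stellar piece, evaluated. [folklore] -/
theorem stellarPiece_apply (hG : IsBased x₀ G) (hg : ∀ j, IsBased x₀ (g j)) (hGg : IsStellar G g)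
    (j : Fin (k + 1)) (y : Fin k → ℝ) :
    stellarPiece G hG g hg hGg j y = if y ∈ stellarCell j then hat G hG y else x₀ := by
  classical exact piece_apply _ _ _ y

/-- A stellar piece vanishes off the interior of its cell. [folklore] -/
theorem stellarPiece_eq_of_not_mem_interior (hG : IsBased x₀ G) (hg : ∀ j, IsBased x₀ (g j))
    (hGg : IsStellar G g) (j : Fin (k + 1)) (y : Fin k → ℝ) (hy : y ∉ interior (stellarCell j)) :
    stellarPiece G hG g hg hGg j y = x₀ := by
  rw [stellarPiece_apply]
  split_ifs with h
  · exact hat_eq_of_not_mem_interior_stellarCell hG hg hGg h hy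
  · rfl

/-! ### The cell `0`: the affine map `stellarAff₀` -/

/-- The affine map `z ↦ z + (∑ zᵢ - 1) 𝟙` carrying the stellar cell `0` onto the corner simplex,
inverse to the stellar map of the region `0` in corner coordinates. [folklore] -/
def stellarAff₀ (k : ℕ) : AffMap k := ⟨1 + vecMulVec 1 1, -1⟩

/-- `stellarAff₀` is `z ↦ z + (∑ zᵢ - 1) 𝟙`. [folklore] -/
theorem stellarAff₀_apply (y : Fin k → ℝ) (m : Fin k) : stellarAff₀ k y m = y m + (∑ i, y i - 1) := by
  rw [AffMap.apply_def, stellarAff₀]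
  simp only [add_mulVec, one_mulVec, vecMulVec_mulVec, Pi.add_apply, Pi.smul_apply, Pi.neg_apply,
    Pi.one_apply, MulOpposite.smul_eq_mul_unop, MulOpposite.unop_op, one_dotProduct]
  ring

/-- `det (stellarAff₀ k).lin = 1 + k > 0`. [folklore] -/
theorem det_stellarAff₀ : (stellarAff₀ k).lin.det = 1 + k := by
  have h : (stellarAff₀ k).lin = 1 + replicateCol (Fin 1) (1 : Fin k → ℝ) * replicateRow (Fin 1) 1 := by
    ext i j
    simp [stellarAff₀, Matrix.add_apply, Matrix.mul_apply]
  rw [h]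
  refine (det_one_add_replicateCol_mul_replicateRow _ _).trans ?_
  simp [add_comm]

/-- **Barycentric coordinates after `stellarAff₀` are the stellar map of the region `0`.**
[folklore] -/
theorem baryCoords_stellarAff₀ (y : Fin k → ℝ) :
    baryCoords (stellarAff₀ k y) = stellarFun 0 (baryCoords y) := by
  funext i
  refine Fin.cases ?_ (fun m => ?_) i
  · rw [baryCoords_zero, stellarFun_zero, baryCoords_zero]
    simp only [stellarAff₀_apply, Finset.sum_add_distrib, Finset.sum_const, Finset.card_univ,
      Fintype.card_fin, nsmul_eq_mul]
    ring
  · rw [baryCoords_succ, stellarFun_succ, Fin.succAbove_zero, baryCoords_succ, baryCoords_zero,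
      stellarAff₀_apply]
    ring

/-- `stellarAff₀` carries the stellar cell `0` into the corner simplex … [folklore] -/
theorem stellarAff₀_mem {y : Fin k → ℝ} (hy : y ∈ stellarCell (0 : Fin (k + 1))) :
    stellarAff₀ k y ∈ cornerSimplex k := by
  refine mem_cornerSimplex_of_baryCoords fun i => ?_
  rw [baryCoords_stellarAff₀]
  exact (stellarPt 0 (baryPt y hy.1) (fun l => hy.2 l)).2.1 i

/-- … and nothing else. [folklore] -/
theorem mem_stellarCell_zero_of_stellarAff₀_mem {y : Fin k → ℝ} (hy : stellarAff₀ k y ∈ cornerSimplex k) :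
    y ∈ stellarCell (0 : Fin (k + 1)) := by
  have h := (baryCoords_mem hy).1
  simp only [baryCoords_stellarAff₀] at h
  have hk1 : (0 : ℝ) < (k : ℝ) + 1 := by positivity
  have h0 : 0 ≤ baryCoords y 0 := by
    have := h 0; rw [stellarFun_zero] at this
    exact nonneg_of_mul_nonneg_right (by rwa [mul_comm] at this) hk1 |> fun h' => by nlinarith
  have hge : ∀ m : Fin k, baryCoords y 0 ≤ baryCoords y m.succ := fun m => by
    have := h m.succ; rw [stellarFun_succ, Fin.succAbove_zero] at this; linarith
  have hall : ∀ l, baryCoords y 0 ≤ baryCoords y l := fun l => Fin.cases le_rfl hge l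
  exact ⟨mem_cornerSimplex_of_baryCoords fun l => h0.trans (hall l), hall⟩

/-- **The piece on the cell `0` is the hat of the face read through `stellarAff₀`.** If `H` is `h`
read through the stellar map on the region `0`, then
`piece (hat H) (stellarCell 0) = hat h ∘ stellarAff₀`. [folklore] -/
theorem piece_hat_stellarCell_zero (H : C(stdSimplex ℝ (Fin (k + 1)), X)) (hH : IsBased x₀ H)
    (h : C(stdSimplex ℝ (Fin (k + 1)), X)) (hh : IsBased x₀ h)
    (hrel : ∀ (s : stdSimplex ℝ (Fin (k + 1))) (h0 : ∀ l, s 0 ≤ s l), H s = h (stellarPt 0 s h0))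
    (hfr : ∀ y ∈ frontier (stellarCell (0 : Fin (k + 1))), hat H hH y = x₀) (hdet : (stellarAff₀ k).lin.det ≠ 0) :
    piece (hat H hH) (stellarCell 0) hfr = precompAff (hat h hh) (stellarAff₀ k) hdet := by
  classical
  refine ext fun y => ?_
  rw [piece_apply, precompAff_apply]
  by_cases hy : y ∈ stellarCell (0 : Fin (k + 1))
  · rw [if_pos hy, hat_apply_of_mem H hH hy.1, hrel _ (fun l => hy.2 l),
      hat_apply_of_mem h hh (stellarAff₀_mem hy)]
    congr 1
    exact stdSimplex.ext (by
      funext i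
      rw [stellarPt_apply, baryPt_apply, baryCoords_stellarAff₀]; rfl)
  · rw [if_neg hy, hat_apply_of_not_mem h hh fun h' => hy (mem_stellarCell_zero_of_stellarAff₀_mem h')]

/-! ### The cells `j ≥ 1`: transport to the cell `0` by a vertex transposition -/

/-- `vswapAff` exchanges the stellar cells `0` and `j = l + 1`. [folklore] -/
theorem mem_stellarCell_zero_iff_vswapAff (l : Fin k) (y : Fin k → ℝ) :
    y ∈ stellarCell (0 : Fin (k + 1)) ↔ vswapAff l y ∈ stellarCell l.succ := by
  by_cases hy : y ∈ cornerSimplex k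
  · have hy' := (vswapAff_mem_cornerSimplex_iff l y).2 hy
    have hb : ∀ i, baryCoords (vswapAff l y) i = baryCoords y (Equiv.swap 0 l.succ i) := fun i => by
      have := congrArg (fun s : stdSimplex ℝ (Fin (k + 1)) => s i) (baryPt_vswapAff l hy hy')
      simpa [mapCM_apply, Equiv.symm_swap] using this
    simp only [stellarCell, mem_setOf_eq, hy, hy', true_and, hb, Equiv.swap_apply_right]
    constructor
    · intro h i; exact h _
    · intro h i
      have := h (Equiv.swap 0 l.succ i)
      rwa [Equiv.swap_apply_self] at this
  · simp only [stellarCell, mem_setOf_eq, hy, false_and, false_iff, not_and]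
    intro h; exact absurd ((vswapAff_mem_cornerSimplex_iff l y).1 h) hy

/-- Pieces and affine changes of coordinates commute: the piece on the cell `0` of `φ ∘ vswapAff l`
is the piece of `φ` on the cell `l + 1`, precomposed with `vswapAff l`. [folklore] -/
theorem piece_precompAff_vswapAff (φ : CSphere k X x₀) (l : Fin k) {hdet h0 hj} :
    piece (precompAff φ (vswapAff l) hdet) (stellarCell (0 : Fin (k + 1))) h0 =
      precompAff (piece φ (stellarCell l.succ) hj) (vswapAff l) hdet := by
  classical
  refine ext fun y => ?_
  rw [piece_apply, precompAff_apply, precompAff_apply, piece_apply]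
  by_cases hy : y ∈ stellarCell (0 : Fin (k + 1))
  · rw [if_pos hy, if_pos ((mem_stellarCell_zero_iff_vswapAff l y).1 hy)]
  · rw [if_neg hy, if_neg (fun h => hy ((mem_stellarCell_zero_iff_vswapAff l y).2 h))]

/-- **The stellar maps of the regions `j` and `0` correspond under the vertex transposition
`swap 0 j`, through the vertex permutation `cycleRange j * swap 0 j`.** [folklore] -/
theorem stellarPt_mapCM_swap (j : Fin (k + 1)) (s : stdSimplex ℝ (Fin (k + 1)))
    (h0 : ∀ l, s 0 ≤ s l) (hj' : ∀ l, mapCM (Equiv.swap 0 j) s j ≤ mapCM (Equiv.swap 0 j) s l) :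
    stellarPt j (mapCM (Equiv.swap 0 j) s) hj' =
      mapCM (Fin.cycleRange j * Equiv.swap 0 j) (stellarPt 0 s h0) := by
  apply stdSimplex.ext
  funext i
  rw [mapCM_apply, stellarPt_apply, stellarPt_apply]
  have hsymm : ∀ i, (Fin.cycleRange j * Equiv.swap 0 j).symm i =
      Equiv.swap 0 j ((Fin.cycleRange j).symm i) := fun i => by
    simp [Equiv.Perm.mul_def, Equiv.symm_swap]
  rw [hsymm]
  refine Fin.cases ?_ (fun m => ?_) i
  · rw [Fin.cycleRange_symm_zero, Equiv.swap_apply_right, stellarFun_zero, stellarFun_zero, mapCM_apply,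
      Equiv.symm_swap, Equiv.swap_apply_right]
  · rw [Fin.cycleRange_symm_succ, stellarFun_succ, mapCM_apply, mapCM_apply, Equiv.symm_swap,
      Equiv.swap_apply_right]
    -- `l := swap 0 j (succAbove j m)` is nonzero
    set l := Equiv.swap 0 j (j.succAbove m) with hl
    have hl0 : l ≠ 0 := by
      rw [hl]
      intro h
      have h2 := congrArg (Equiv.swap (0 : Fin (k + 1)) j) h
      rw [Equiv.swap_apply_self, Equiv.swap_apply_left] at h2
      exact Fin.succAbove_ne j m h2
    obtain ⟨n, hn⟩ := Fin.exists_succ_eq.2 hl0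
    rw [← hn, stellarFun_succ, Fin.succAbove_zero]

/-- The sign of `cycleRange j * swap 0 j` is `-(-1)^j`. [folklore] -/
theorem permSign_cycleRange_mul_swap (j : Fin (k + 1)) (hj : j ≠ 0) :
    permSign (Fin.cycleRange j * Equiv.swap 0 j) = -((-1 : ℤ) ^ (j : ℕ)) := by
  rw [permSign_mul, permSign_swap hj.symm, permSign, Fin.sign_cycleRange]
  simp

/-- **The class of the `j`-th stellar piece is `toClass (hat gⱼ) ^ (-1)^j`.** [folklore] -/
theorem toClass_stellarPiece [NeZero k] (hG : IsBased x₀ G) (hg : ∀ j, IsBased x₀ (g j))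
    (hGg : IsStellar G g) (j : Fin (k + 1)) :
    (stellarPiece G hG g hg hGg j).toClass = (hat (g j) (hg j)).toClass ^ ((-1 : ℤ) ^ (j : ℕ)) := by
  have hdet0 : (stellarAff₀ k).lin.det ≠ 0 := by rw [det_stellarAff₀]; positivity
  have hpos0 : 0 < (stellarAff₀ k).lin.det := by rw [det_stellarAff₀]; positivity
  rcases Fin.eq_zero_or_eq_succ j with rfl | ⟨l, rfl⟩
  · -- the cell `0`
    have key : stellarPiece G hG g hg hGg 0 = precompAff (hat (g 0) (hg 0)) (stellarAff₀ k) hdet0 :=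
      piece_hat_stellarCell_zero G hG (g 0) (hg 0) (fun s h0 => hGg s 0 h0) _ hdet0
    rw [key, toClass_precompAff, signDet_of_pos hpos0]
    simp
  · -- the cell `l + 1`: move it to `0` by `τ = swap 0 (l+1)`
    set τ : Equiv.Perm (Fin (k + 1)) := Equiv.swap 0 l.succ with hτ
    set ρ : Equiv.Perm (Fin (k + 1)) := Fin.cycleRange l.succ * τ with hρ
    set H : C(stdSimplex ℝ (Fin (k + 1)), X) := G.comp (mapCM τ) with hH
    have hHb : IsBased x₀ H := hG.comp_mapCM τ
    set h : C(stdSimplex ℝ (Fin (k + 1)), X) := (g l.succ).comp (mapCM ρ) with hh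
    have hhb : IsBased x₀ h := (hg l.succ).comp_mapCM ρ
    -- `H` is `h` read through the stellar map on the region `0`
    have hrel : ∀ (s : stdSimplex ℝ (Fin (k + 1))) (h0 : ∀ l', s 0 ≤ s l'), H s = h (stellarPt 0 s h0) := by
      intro s h0
      have hreg : ∀ l', mapCM τ s l.succ ≤ mapCM τ s l' := fun l' => by
        rw [mapCM_apply, mapCM_apply, hτ, Equiv.symm_swap, Equiv.swap_apply_right]; exact h0 _
      rw [hH, ContinuousMap.comp_apply, hGg (mapCM τ s) l.succ hreg,
        stellarPt_mapCM_swap l.succ s h0 hreg, hh, ContinuousMap.comp_apply]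
    -- the piece on the cell `0` of `hat H`, computed two ways
    have hfr : ∀ y ∈ frontier (stellarCell (0 : Fin (k + 1))), hat H hHb y = x₀ := by
      intro y hy
      have hy1 : y ∈ stellarCell (0 : Fin (k + 1)) := (isClosed_stellarCell 0).frontier_subset hy
      have hy2 : y ∉ interior (stellarCell (0 : Fin (k + 1))) :=
        disjoint_left.1 disjoint_interior_frontier.symm hy
      rw [hat_apply_of_mem H hHb hy1.1, hrel _ (fun l' => hy1.2 l')]
      exact hhb _ (exists_stellarPt_eq_zero 0 _ _ ((eq_or_zero_of_not_mem_interior hy1 hy2).imp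
        (fun ⟨l', hl', h'⟩ => ⟨l', hl', h'⟩) fun ⟨i, hi⟩ => ⟨i, hi⟩))
    have way1 : piece (hat H hHb) (stellarCell 0) hfr = precompAff (hat h hhb) (stellarAff₀ k) hdet0 :=
      piece_hat_stellarCell_zero H hHb h hhb hrel hfr hdet0
    have hHhat : hat H hHb = precompAff (hat G hG) (vswapAff l) (det_vswapAff_ne_zero l) :=
      hat_comp_mapCM_swap_zero G hG l
    have way2 : piece (hat H hHb) (stellarCell 0) hfr =
        precompAff (stellarPiece G hG g hg hGg l.succ) (vswapAff l) (det_vswapAff_ne_zero l) := by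
      have : piece (hat H hHb) (stellarCell 0) hfr =
          piece (precompAff (hat G hG) (vswapAff l) (det_vswapAff_ne_zero l)) (stellarCell 0)
            (fun y hy => by rw [← hHhat]; exact hfr y hy) := by
        refine ext fun y => ?_
        show piece _ _ _ y = piece _ _ _ y
        classical
        rw [piece_apply, piece_apply, hHhat]
      rw [this]
      exact piece_precompAff_vswapAff (hat G hG) l
    -- compare the classes
    have hc1 := congrArg toClass way1
    rw [way2, toClass_precompAff, toClass_precompAff, signDet_of_pos hpos0, zpow_one,
      signDet_of_neg (by rw [det_vswapAff]; norm_num)] at hc1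
    have hcls : (hat h hhb).toClass = (hat (g l.succ) (hg l.succ)).toClass ^ permSign ρ :=
      toClass_hat_comp_mapCM ρ (g l.succ) (hg l.succ)
    rw [hcls, hρ, permSign_cycleRange_mul_swap l.succ (Fin.succ_ne_zero l)] at hc1
    -- `c ^ (-1) = a ^ (-(-1)^j)` gives `c = a ^ ((-1)^j)`
    have := congrArg (fun x => x ^ (-1 : ℤ)) hc1
    simp only [← zpow_mul] at this
    simpa using this

end CSphere

end Literature.AlgebraicTopology.Homotopy

end
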